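import Summits.HodgeConjecture.CorCM.CommonQuarticCMSubfieldOcticStructure
import HarnessLib

/-!
# The field of definition `F(z₁(a), x₂(b))` of a one-unsplit-pair type of an octic CM field over a quartic CM subfield

COR-CM (cell `pub-hodgecm2`, binder seat `b16` gen 50, count-neutral claim CM44-COMMONQUARTIC, file F3b; theorems only,
no definition, no named fact, no `sorry`).  NEW as packaged, hence under `Summits/`.  Sequel of
`CorCM/CommonQuarticCMSubfieldOcticStructure` (`τ`, `a`, `b`, `F = normalClosure ℚ k⁺ ℂ`, fibre lemmas); `HC_CM` is
neither used nor asserted.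

SETTING.  `K` CM with `[K:ℚ] = 2[k:ℚ]` over a quartic CM field `k` along `e`, `τ` the involution of `K` over `e(k)`,
`a ∈ k` anti-real, `b ∈ K` anti-real and `τ`-anti; a type `Φ` of `K` with ONE UNSPLIT PAIR: the fibre of `z₁` inside `Φ`,
`z₂ ∉ {z₁, z̄₁}`, `x₂ ∈ Φ` over `z₂`, `x₂ ∘ τ ∉ Φ`.

* `mem_iff_of_unsplit_of_split` — `Φ = {fibre of z₁} ∪ {x₂, \overline{x₂∘τ}}`.
* **`forall_smul_mem_iff_of_fix`** — every automorphism of `ℂ` fixing `F` pointwise and fixing `α = z₁(a)`,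
  `β = x₂(b)` stabilises `Φ`: `Φ` is DEFINED OVER the CM biquadratic field `F(α, β) = k⁺(√Δ₁, √(Δ₂d₂))` — the input
  shape `hdef` of the four-ratio theorems of `CorCM/CommonQuarticCMSubfieldReflexCoincidences` (with the engine
  `CorCM/CommonQuarticCMSubfieldBiquadraticLattice`).  The proof: `σ` fixes the place `z₁` (`k = k⁺ ⊕ k⁺a`), and
  `σ•x₂` agrees with `x₂` on `e(k⁺)` and at `b`, hence lies in `{x₂, \overline{x₂τ}} ⊆ Φ`; an injective self-map of
  the finite set `Φ` is onto.

## References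

* [Shimura1998] G. Shimura, *Abelian Varieties with Complex Multiplication and Modular Functions*, §8.3 (reflex field =
  fixed field of the stabiliser), §8.4 (2)(C), §18.1.
* [Streng2010] M. Streng, *Complex multiplication of abelian surfaces*, Ch. I §3, Lemma I.3.4 and Example I.7.5.
-/

set_option autoImplicit false

noncomputable section

open scoped ComplexConjugate
open NumberField NumberField.ComplexEmbedding Module

namespace Summit.HodgeConjecture.CorCM.OcticOverQuartic

open Literature.NumberTheory.ComplexMultiplication
open Literature.AlgebraicGeometry.Motives (CMType)
open Literature.AlgebraicGeometry.Pohlmann1968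

/-! ### §6 The field of definition of a one-unsplit-pair type -/

section Definition

variable {k K : Type} [Field k] [NumberField k] [IsCMField k] [Field K] [NumberField K] [IsCMField K]

/-- **A one-unsplit-pair type is `{fibre of z₁} ∪ {x₂, \overline{x₂∘τ}}`.**  `k` quartic CM, `[K:ℚ] = 2[k:ℚ]`, the fibre
of `z₁` inside `Φ`, `z₂ ∉ {z₁, z̄₁}`, `x₂ ∈ Φ` over `z₂` with `x₂∘τ ∉ Φ`. [cite: Shimura1998, §8.4 (2)(C)] -/
theorem mem_iff_of_unsplit_of_split (hk : finrank ℚ k = 4) (e : k →+* K) (h2 : finrank ℚ K = 2 * finrank ℚ k)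
    (τ : K ≃ₐ[ℚ] K) (hτ1 : τ ≠ 1) (hτe : ∀ x : k, τ (e x) = e x) (Φ : CMType K) {z₁ z₂ : k →+* ℂ}
    (hz₁ : ∀ y : K →+* ℂ, y.comp e = z₁ → y ∈ Φ.1) (hz₂ : z₂ ≠ z₁) (hz₂' : z₂ ≠ (starRingAut : ℂ ≃+* ℂ) • z₁)
    {x₂ : K →+* ℂ} (hx₂e : x₂.comp e = z₂) (hx₂Φ : x₂ ∈ Φ.1) (hsplit : x₂.comp τ.toRingEquiv.toRingHom ∉ Φ.1)
    (y : K →+* ℂ) :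
    y ∈ Φ.1 ↔ y.comp e = z₁ ∨ y = x₂ ∨ y = (starRingAut : ℂ ≃+* ℂ) • x₂.comp τ.toRingEquiv.toRingHom := by
  have hCM := isCMTypeWith_conj Φ
  set c : ℂ ≃+* ℂ := starRingAut with hc
  constructor
  · intro hy
    by_cases h1 : y.comp e = z₁
    · exact Or.inl h1
    right
    by_cases h1' : y.comp e = c • z₁
    · exfalso
      have : (c • y).comp e = z₁ := by rw [smul_comp_ringHom, h1', conj_smul_conj_smul]
      exact (hCM.rho_smul_mem_iff y).1 (hz₁ _ this) hy
    rcases eq_or_eq_conj_of_finrank_eq_four hk hz₂ hz₂' (y.comp e) h1 h1' with h | h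
    · -- over `z₂`: `y ∈ {x₂, x₂τ}`
      rcases (comp_eq_comp_iff e h2 τ hτ1 hτe x₂ y).1 (h.trans hx₂e.symm) with h' | h'
      · exact Or.inl h'
      · exact absurd (h' ▸ hy) hsplit
    · -- over `z̄₂`: `ȳ ∈ {x₂, x₂τ}`
      have hcy : (c • y).comp e = x₂.comp e := by rw [smul_comp_ringHom, h, conj_smul_conj_smul, hx₂e]
      rcases (comp_eq_comp_iff e h2 τ hτ1 hτe x₂ (c • y)).1 hcy with h' | h'
      · exfalso
        exact (hCM.rho_smul_mem_iff y).1 (h' ▸ hx₂Φ) hy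
      · right
        have : y = c • c • y := (conj_smul_conj_smul y).symm
        rw [this, h']
  · rintro (h | rfl | rfl)
    · exact hz₁ y h
    · exact hx₂Φ
    · exact (hCM.rho_smul_mem_iff _).2 hsplit

/-- **THE FIELD OF DEFINITION `F(z₁(a), x₂(b))`.**  In the setting of `mem_iff_of_unsplit_of_split`, with `a ∈ k`
anti-real and `b ∈ K` anti-real and `τ`-anti (§3): every automorphism `σ` of `ℂ` fixing `F = normalClosure ℚ k⁺ ℂ`
pointwise and fixing `α = z₁(a)` and `β = x₂(b)` satisfies `σΦ = Φ`.  (`σ` fixes the place `z₁`, and `σ•x₂` agrees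
with `x₂` on `e(k⁺)` and at `b`, so lies in `{x₂, \overline{x₂τ}} ⊆ Φ` by §5; a self-map of the finite set `Φ`
induced by the injective `σ` is onto.) [cite: Shimura1998, §8.3 and §8.4 (2)(C)] -/
theorem forall_smul_mem_iff_of_fix (hk : finrank ℚ k = 4) (e : k →+* K) (h2 : finrank ℚ K = 2 * finrank ℚ k)
    (τ : K ≃ₐ[ℚ] K) (hτ1 : τ ≠ 1) (hτe : ∀ x : k, τ (e x) = e x) {a : k} (ha0 : a ≠ 0)
    (ha : IsCMField.complexConj k a = -a) {b : K} (hb0 : b ≠ 0) (hρb : IsCMField.complexConj K b = -b)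
    (hτb : τ b = -b) (Φ : CMType K) {z₁ z₂ : k →+* ℂ} (hz₁ : ∀ y : K →+* ℂ, y.comp e = z₁ → y ∈ Φ.1)
    (hz₂ : z₂ ≠ z₁) (hz₂' : z₂ ≠ (starRingAut : ℂ ≃+* ℂ) • z₁) {x₂ : K →+* ℂ} (hx₂e : x₂.comp e = z₂)
    (hx₂Φ : x₂ ∈ Φ.1) (hsplit : x₂.comp τ.toRingEquiv.toRingHom ∉ Φ.1) {σ : ℂ ≃+* ℂ}
    (hσF : ∀ t : ℂ, t ∈ IntermediateField.normalClosure ℚ (maximalRealSubfield k) ℂ → σ t = t) (hσα : σ (z₁ a) = z₁ a)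
    (hσβ : σ (x₂ b) = x₂ b) : ∀ x : K →+* ℂ, σ • x ∈ Φ.1 ↔ x ∈ Φ.1 := by
  have hCM := isCMTypeWith_conj Φ
  have hττ := algEquiv_over_apply_apply e h2 τ hτ1 hτe
  set c : ℂ ≃+* ℂ := starRingAut with hc
  have hmem := mem_iff_of_unsplit_of_split hk e h2 τ hτ1 hτe Φ hz₁ hz₂ hz₂' hx₂e hx₂Φ hsplit
  -- `σ` fixes the place `z₁`
  have hσz₁ : σ • z₁ = z₁ := by
    refine RingHom.ext fun x => ?_
    obtain ⟨r, s, hr, hs, rfl⟩ := exists_real_add_real_mul ha0 ha x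
    rw [ringEquiv_smul_apply, map_add, map_mul, map_add, map_mul, hσF _ (apply_mem_normalClosure z₁ hr),
      hσF _ (apply_mem_normalClosure z₁ hs), hσα]
  -- `σ • x₂ ∈ {x₂, \overline{x₂τ}}`
  have hσx₂ : σ • x₂ = x₂ ∨ σ • x₂ = c • x₂.comp τ.toRingEquiv.toRingHom := by
    refine eq_or_eq_conj_smul_comp_of_agree e h2 τ hτ1 hτe ha0 ha hb0 hρb hτb x₂ (σ • x₂) (fun r hr => ?_) hσβ
    rw [ringEquiv_smul_apply]
    have : x₂ (e r) = z₂ r := by rw [← hx₂e]; rfl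
    rw [this]
    exact hσF _ (apply_mem_normalClosure z₂ hr)
  -- `Φ` is mapped into itself
  have hmaps : Set.MapsTo (fun x : K →+* ℂ => σ • x) Φ.1 Φ.1 := by
    intro y hy
    rcases (hmem y).1 hy with h | rfl | rfl
    · exact hz₁ _ (by rw [smul_comp_ringHom, h, hσz₁])
    · rcases hσx₂ with h' | h'
      · exact (hmem _).2 (Or.inr (Or.inl h'))
      · exact (hmem _).2 (Or.inr (Or.inr h'))
    · have hcomm : σ • c • x₂.comp τ.toRingEquiv.toRingHom = c • (σ • x₂).comp τ.toRingEquiv.toRingHom := by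
        rw [hc, hCM.comm]; rfl
      change σ • c • x₂.comp τ.toRingEquiv.toRingHom ∈ Φ.1
      rw [hcomm]
      rcases hσx₂ with h' | h'
      · rw [h']; exact (hmem _).2 (Or.inr (Or.inr rfl))
      · rw [h']
        have : (c • x₂.comp τ.toRingEquiv.toRingHom).comp τ.toRingEquiv.toRingHom = c • x₂ :=
          RingHom.ext fun t => by
            change conj (x₂ (τ (τ t))) = conj (x₂ t)
            rw [hττ]
        rw [this, hc, conj_smul_conj_smul]
        exact hx₂Φ
  have hbij := (Set.toFinite Φ.1).injOn_iff_bijOn_of_mapsTo hmaps |>.1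
    (fun y _ y' _ h => MulAction.injective σ h)
  intro x
  constructor
  · intro hx
    obtain ⟨y, hy, hyx⟩ := hbij.surjOn hx
    rw [← MulAction.injective σ hyx]
    exact hy
  · exact fun hx => hmaps hx

end Definition

end Summit.HodgeConjecture.CorCM.OcticOverQuartic

end
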